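import Summits.ResolutionOfSingularities.ResolutionOfSingularities.Theorems.WeightedInvariantIota3TauDescentLowDim
import Literature.RingTheory.RegularLocalRing.QuotientDVR
import HarnessLib

/-!
# (desc-τ), CASE A′ LOCATED: over a base of dimension two a tie position has centre `P₀ = 𝔪_T T'` and order `ν = ord_T g`
# (door `HypersurfaceCentreConstruction`, stmt-ResolutionOfSingularities-19897; registered stub `stub_keyRungGrHomLE_three`, gap (1) (desc-τ))

Topic: `Summits/ResolutionOfSingularities/ResolutionOfSingularities/Theorems`. Helper for the door item `HypersurfaceCentreConstruction`
(stmt-ResolutionOfSingularities-19897, route `WeightedInvariant`), line `local-engine`, def-free.  Sequel of …Iota3TauDescentLowDim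
(`Iota3.isTiePosition_descent_of_cases`: (desc-τ) ⟸ (A′) «no tie over a base of dimension two» ∧ (B) «equal-dimension descent»).
THIS FILE pins down where a hypothetical case-(A′) tie sits, which is the first step of the flat-pullback argument for (A′)
(pull the no-drop successor of …TieNoDropSuccessor back to the cobordant blow-up of the TWO-dimensional `T` at its lex-maximal centre and
contradict `LexMaxOrderDrop.adicOrder_transform_lt_of_isLexMax`):

* §1 `Iota3.eq_of_le_of_ringKrullDim_quotient_eq_one` — two primes `P ≤ Q` with `R ⧸ P` regular of dimension one and `dim R ⧸ Q = 1`
  coincide (the image of `Q` in the discrete valuation ring `R ⧸ P` is `⊥` or maximal).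
* §2 `Iota3.isPrime_map_maximalIdeal`, `Iota3.ringKrullDim_quotient_map_maximalIdeal` — along a local, formally smooth, essentially-of-finite-type
  `φ : T → T'` of regular local rings the extended ideal `𝔪_T T'` is prime with regular quotient of dimension `dim T' - dim T` (the closed fibre).
* §3 **`Iota3.topStratumPrime_eq_map_maximalIdeal_of_isTiePosition_map`** — if `dim T = 2` and `(T', φ g)` is a tie position then the generic
  prime of its top `(ν ; ε)`-stratum is `P₀ = 𝔪_T T'`: the order `ν` of `φ g` is that of `g` (`φ` reflects the powers of the maximal ideals), so
  `φ g ∈ (𝔪_T T')^ν` keeps its order at the prime `𝔪_T T'` (`EquimultipleCentre.iotaOrd_localization_eq_of_mem_pow`), which therefore lies on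
  the top stratum `V(P₀)` (`ε = 0`); both `T' ⧸ P₀` and the closed fibre `T' ⧸ 𝔪_T T'` have dimension one, so `P₀ = 𝔪_T T'` (§1).
  Packaged: `Iota3.isTiePosition_map_dichotomy_of_ringKrullDim_eq_two` (the tie presentation's plane `(x, y)` IS `𝔪_T T'`, and
  `ν = ord_T g` with `g ∈ 𝔪_T^ν ∖ 𝔪_T^{ν+1}`).
* §4 `Iota3.isTiePosition_descent_of_cases'` — (desc-τ) ⟸ (A″) «no tie presentation `(x, y, z; q, r; λ)` of `(T', φ g)` with `(x, y) = 𝔪_T T'`,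
  `dim T = 2`» ∧ (B).

[OURS · L1 W4.3 · (desc-τ) case A′ located]  Replaces the role of NO printed item; NOT a statement of the manuscript under review
[claim: Hironaka2017, status: under-review]; candidates stay candidates; AI work, weaker than expert review.  No definition; no axiom.

## References

* H. Matsumura, *Commutative Ring Theory* (1986), Thm. 11.2, Thm. 15.1, §22 Cor. to Thm. 22.5, Thm. 23.7. [Matsumura1987]
* O. Zariski, P. Samuel, *Commutative Algebra* II, Ch. VIII §1 Thm. 1 (order along a prime of a regular local ring). [ZariskiSamuel1960]
-/

noncomputable section

set_option linter.dupNamespace false -- mandated namespace `Summit.<Summit>.<Problem>` of this single-conjunct summit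

open IsLocalRing Literature.AlgebraicGeometry.Resolution
open Summit.ResolutionOfSingularities.ResolutionOfSingularities.Theorems
open Summit.ResolutionOfSingularities.ResolutionOfSingularities.Theorems.ContactCylinder

namespace Summit.ResolutionOfSingularities.ResolutionOfSingularities.Cruxes.HypersurfaceCentreConstruction.LocalEngine

namespace Iota3

/-! ## §1 Primes of coheight one are incomparable -/

/-- **Two primes `P ≤ Q` with `R ⧸ P` regular of dimension one and `dim R ⧸ Q = 1` are equal**: in the discrete valuation ring `R ⧸ P` the
image of `Q` is a prime, hence `⊥` (so `Q ≤ P`) or the maximal ideal (so `Q` is maximal and `dim R ⧸ Q = 0`). [cite: Matsumura1987, Thm. 11.2] -/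
theorem eq_of_le_of_ringKrullDim_quotient_eq_one {R : Type} [CommRing R] {P Q : Ideal R} [Q.IsPrime]
    (hreg : IsRegularLocalRing (R ⧸ P)) (hP : ringKrullDim (R ⧸ P) = 1) (hQ : ringKrullDim (R ⧸ Q) = 1) (hle : P ≤ Q) :
    P = Q := by
  haveI := hreg
  haveI := isDomain_of_isRegularLocalRing (R ⧸ P)
  haveI : IsDiscreteValuationRing (R ⧸ P) :=
    Literature.RingTheory.RegularLocalRing.isDiscreteValuationRing_of_ringKrullDim_eq_one hP
  have hker : RingHom.ker (Ideal.Quotient.mk P) ≤ Q := by rw [Ideal.mk_ker]; exact hle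
  set Q' : Ideal (R ⧸ P) := Q.map (Ideal.Quotient.mk P) with hQ'
  haveI hQ'p : Q'.IsPrime := Ideal.map_isPrime_of_surjective Ideal.Quotient.mk_surjective hker
  by_cases hbot : Q' = ⊥
  · -- `Q ≤ P`
    have hQP : Q ≤ P := by
      have h := (Ideal.map_eq_bot_iff_le_ker (f := Ideal.Quotient.mk P) (I := Q)).mp hbot
      rwa [Ideal.mk_ker] at h
    exact le_antisymm hle hQP
  · -- `Q' = 𝔪`, so `Q` is maximal and `R ⧸ Q` is a field: `dim = 0`
    exfalso
    have hmax' : Q'.IsMaximal := Ideal.IsPrime.isMaximal hQ'p hbot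
    have hcomap : Q'.comap (Ideal.Quotient.mk P) = Q := by
      rw [hQ', Ideal.comap_map_of_surjective _ Ideal.Quotient.mk_surjective, sup_eq_left]
      rintro x hx
      exact hker hx
    haveI hQmax : Q.IsMaximal := by
      rw [← hcomap]; exact Ideal.comap_isMaximal_of_surjective _ Ideal.Quotient.mk_surjective
    haveI : IsField (R ⧸ Q) := (Ideal.Quotient.maximal_ideal_iff_isField_quotient Q).mp hQmax
    letI : Field (R ⧸ Q) := this.toField
    have h0 : ringKrullDim (R ⧸ Q) = 0 := ringKrullDim_eq_zero_of_field (R ⧸ Q)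
    rw [h0] at hQ
    exact zero_ne_one hQ

/-! ## §2 The closed fibre ideal `𝔪_T T'` -/

section Fibre

variable (T T' : Type) [CommRing T] [CommRing T'] [IsRegularLocalRing T] [IsRegularLocalRing T'] [Algebra T T']
  [IsLocalHom (algebraMap T T')] [Algebra.FormallySmooth T T'] [Algebra.EssFiniteType T T']

/-- `𝔪_T T'` is a prime of `T'` (its quotient, the closed fibre, is a regular local ring). [cite: Matsumura1987, Thm. 23.7] -/
theorem isPrime_map_maximalIdeal : ((maximalIdeal T).map (algebraMap T T')).IsPrime := by
  haveI : IsRegularLocalRing (T' ⧸ (maximalIdeal T).map (algebraMap T T')) :=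
    IotaOrderEssSmooth.isRegularLocalRing_fibre_of_formallySmooth T T'
  haveI := isDomain_of_isRegularLocalRing (T' ⧸ (maximalIdeal T).map (algebraMap T T'))
  exact (Ideal.Quotient.isDomain_iff_prime _).mp inferInstance

/-- `dim (T' ⧸ 𝔪_T T') = dim T' - dim T`, in `ℕ`. [cite: Matsumura1987, Thm. 15.1] -/
theorem ringKrullDim_quotient_map_maximalIdeal {a b : ℕ} (ha : ringKrullDim T = a) (hb : ringKrullDim T' = b) :
    ringKrullDim (T' ⧸ (maximalIdeal T).map (algebraMap T T')) = (b - a : ℕ) := by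
  obtain ⟨a', b', c, ha', hb', hc, habc⟩ := EssSmoothLE2.exists_dims T T'
  have haa : a' = a := by rw [ha'] at ha; exact_mod_cast ha
  have hbb : b' = b := by rw [hb'] at hb; exact_mod_cast hb
  rw [hc]
  have : c = b - a := by omega
  rw [this]

end Fibre

/-! ## §3 Over a base of dimension two a tie position has centre `𝔪_T T'` -/

section BaseTwo

variable (T T' : Type) [CommRing T] [CommRing T'] [IsRegularLocalRing T] [IsRegularLocalRing T'] [Algebra T T']
  [IsLocalHom (algebraMap T T')] [Algebra.FormallySmooth T T'] [Algebra.EssFiniteType T T']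

/-- **CASE A′ LOCATED.**  `φ : T → T'` local, formally smooth, essentially of finite type between regular local rings, `dim T = 2`; if
`(T', φ g)` is a tie position then the generic prime of its top `(ν ; ε)`-stratum is the closed-fibre ideal: `P₀ = 𝔪_T T'`.
[OURS · (desc-τ) case A′] [cite: ZariskiSamuel1960, Ch. VIII §1 Thm. 1] -/
theorem topStratumPrime_eq_map_maximalIdeal_of_isTiePosition_map (hdimT : ringKrullDim T = (2 : ℕ)) {g : T}
    (ht : IsTiePosition T' (algebraMap T T' g)) :
    topStratumPrime iotaOrdEps T' (algebraMap T T' g) = (maximalIdeal T).map (algebraMap T T') := by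
  have hf0 : algebraMap T T' g ≠ 0 := ht.ne_zero
  have hf𝔪 : algebraMap T T' g ∈ maximalIdeal T' := ht.mem_maximalIdeal
  have h3 : ringKrullDim T' = (3 : ℕ) := (ringKrullDim_eq_of_isTiePosition_map T T' ht).1
  -- the closed fibre ideal: prime, regular quotient of dimension one
  haveI hP' := isPrime_map_maximalIdeal T T'
  have hdimP' : ringKrullDim (T' ⧸ (maximalIdeal T).map (algebraMap T T')) = 1 := by
    rw [ringKrullDim_quotient_map_maximalIdeal T T' hdimT h3]; rfl
  -- unpack the tie
  obtain ⟨_, -, hε, hq1, x, y, z, q, r, lam, -, -, ν, -, hfν, hfν1, -, -⟩ := ht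
  have hν : iotaOrd T' (algebraMap T T' g) = ν := (iotaOrd_eq_natCast_iff T' _ ν).mpr ⟨hfν, hfν1⟩
  -- `g ∈ 𝔪_T^ν`, so `φ g ∈ (𝔪_T T')^ν`
  have hgν : g ∈ maximalIdeal T ^ ν := (IotaOrderEssSmooth.mem_maximalIdeal_pow_iff_of_formallySmooth T T' ν g).mpr hfν
  have hfP'ν : algebraMap T T' g ∈ (maximalIdeal T).map (algebraMap T T') ^ ν := by
    rw [← Ideal.map_pow]; exact Ideal.mem_map_of_mem _ hgν
  -- the top stratum is `V(P₀)` with `T' ⧸ P₀` regular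
  obtain ⟨hP₀, hreg₀, -, hS, -, -⟩ := topStratumPrime_iotaOrdEps_spec (le_of_eq h3) hf0 hf𝔪 hν
  -- the order is kept at `𝔪_T T'`, so it lies on the top stratum
  have hord : iotaOrd (Localization.AtPrime ((maximalIdeal T).map (algebraMap T T')))
      (algebraMap T' (Localization.AtPrime ((maximalIdeal T).map (algebraMap T T'))) (algebraMap T T' g)) =
      iotaOrd T' (algebraMap T T' g) :=
    EquimultipleCentre.iotaOrd_localization_eq_of_mem_pow ((maximalIdeal T).map (algebraMap T T')) le_rfl hν hfP'ν
  have hmem : (⟨(maximalIdeal T).map (algebraMap T T'), hP'⟩ : PrimeSpectrum T') ∈ topStratum iotaOrdEps T' (algebraMap T T' g) := by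
    rw [topStratum_iotaOrdEps_eq_topStratum_iotaOrd_of_iotaEps_eq_zero hf𝔪 hε, ContactCylinder.mem_topStratum_iff]
    exact hord
  have hle : topStratumPrime iotaOrdEps T' (algebraMap T T' g) ≤ (maximalIdeal T).map (algebraMap T T') := by
    rw [hS] at hmem; exact hmem
  exact eq_of_le_of_ringKrullDim_quotient_eq_one hreg₀ hq1 hdimP' hle

/-- **The order is that of `g`**: at a tie position `(T', φ g)` the element `g` lies in `𝔪_T^ν ∖ 𝔪_T^{ν+1}` for the `ν` with
`φ g ∈ 𝔪'^ν ∖ 𝔪'^{ν+1}` (`φ` reflects the powers of the maximal ideals). [cite: Matsumura1987, §22 Cor. to Thm. 22.5] -/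
theorem mem_pow_and_not_mem_of_map {g : T} {ν : ℕ} (hfν : algebraMap T T' g ∈ maximalIdeal T' ^ ν)
    (hfν1 : algebraMap T T' g ∉ maximalIdeal T' ^ (ν + 1)) : g ∈ maximalIdeal T ^ ν ∧ g ∉ maximalIdeal T ^ (ν + 1) :=
  ⟨(IotaOrderEssSmooth.mem_maximalIdeal_pow_iff_of_formallySmooth T T' ν g).mpr hfν,
    fun h => hfν1 ((IotaOrderEssSmooth.mem_maximalIdeal_pow_iff_of_formallySmooth T T' (ν + 1) g).mp h)⟩

/-- **CASE A′ AS A STATEMENT ABOUT PRESENTATIONS.**  Over a base of dimension two, a tie position `(T', φ g)` comes with a tie presentation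
`(x, y, z; q, r; λ)` whose plane is the closed fibre ideal, `(x, y) = 𝔪_T T'`, and with `g ∈ 𝔪_T^ν ∖ 𝔪_T^{ν+1}`, `φ g ∈ 𝔪'^ν ∖ 𝔪'^{ν+1}` for one `ν`.
[OURS · (desc-τ) case A′] -/
theorem isTiePosition_map_dichotomy_of_ringKrullDim_eq_two (hdimT : ringKrullDim T = (2 : ℕ)) {g : T}
    (ht : IsTiePosition T' (algebraMap T T' g)) :
    ringKrullDim T' = (3 : ℕ) ∧ iotaEps T' (algebraMap T T' g) = 0 ∧
      ∃ (x y z : T') (q r : ℕ) (lam : T') (ν : ℕ), IsTiePresentation T' (algebraMap T T' g) x y z q r lam ∧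
        Ideal.span {x, y} = (maximalIdeal T).map (algebraMap T T') ∧
        g ∈ maximalIdeal T ^ ν ∧ g ∉ maximalIdeal T ^ (ν + 1) ∧
        algebraMap T T' g ∈ maximalIdeal T' ^ ν ∧ algebraMap T T' g ∉ maximalIdeal T' ^ (ν + 1) := by
  have hP₀ := topStratumPrime_eq_map_maximalIdeal_of_isTiePosition_map T T' hdimT ht
  obtain ⟨_, h3, hε, -, x, y, z, q, r, lam, hpres⟩ := ht
  obtain ⟨hxyz, hP₀xy, ν, hP, hfν, hfν1, hlex, hmem⟩ := hpres
  refine ⟨by rw [h3]; rfl, hε, x, y, z, q, r, lam, ν, ⟨hxyz, hP₀xy, ν, hP, hfν, hfν1, hlex, hmem⟩, hP₀xy ▸ hP₀,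
    (mem_pow_and_not_mem_of_map T T' hfν hfν1).1, (mem_pow_and_not_mem_of_map T T' hfν hfν1).2, hfν, hfν1⟩

end BaseTwo

/-! ## §4 (desc-τ) from the located case A″ and case B -/

/-- **(desc-τ) ⟸ (A″) ∧ (B)**, with (A″) the LOCATED form of case A′: «for `dim T = 2`, `dim T' = 3`, no tie presentation `(x, y, z; q, r; λ)` of
`(T', φ g)` has `(x, y) = 𝔪_T T'`».  [OURS · (desc-τ) reduction] -/
theorem isTiePosition_descent_of_cases'
    (hA : ∀ (T T' : Type) [CommRing T] [IsRegularLocalRing T] [CommRing T'] [IsRegularLocalRing T'] [Algebra T T']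
      [IsLocalHom (algebraMap T T')] [Algebra.FormallySmooth T T'] [Algebra.EssFiniteType T T'] (g : T)
      (x y z : T') (q r : ℕ) (lam : T'),
      ringKrullDim T = (2 : ℕ) → ringKrullDim T' = (3 : ℕ) → Ideal.span {x, y} = (maximalIdeal T).map (algebraMap T T') →
      ¬ IsTiePresentation T' (algebraMap T T' g) x y z q r lam)
    (hB : ∀ (T T' : Type) [CommRing T] [IsRegularLocalRing T] [CommRing T'] [IsRegularLocalRing T'] [Algebra T T']
      [IsLocalHom (algebraMap T T')] [Algebra.FormallySmooth T T'] [Algebra.EssFiniteType T T'] (g : T),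
      ringKrullDim T = (3 : ℕ) → ringKrullDim T' = (3 : ℕ) → (maximalIdeal T).map (algebraMap T T') = maximalIdeal T' →
      IsTiePosition T' (algebraMap T T' g) → IsTiePosition T g) :
    ∀ (T T' : Type) [CommRing T] [IsRegularLocalRing T] [CommRing T'] [IsRegularLocalRing T'] [Algebra T T']
      [IsLocalHom (algebraMap T T')] [Algebra.FormallySmooth T T'] [Algebra.EssFiniteType T T'] (g : T),
      ringKrullDim T' ≤ 3 → IsTiePosition T' (algebraMap T T' g) → IsTiePosition T g := by
  refine isTiePosition_descent_of_cases ?_ hB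
  intro T T' _ _ _ _ _ _ _ _ g h2 h3 ht
  obtain ⟨-, -, x, y, z, q, r, lam, ν, hpres, hxy, -⟩ := isTiePosition_map_dichotomy_of_ringKrullDim_eq_two T T' h2 ht
  exact hA T T' g x y z q r lam h2 h3 hxy hpres

end Iota3

end Summit.ResolutionOfSingularities.ResolutionOfSingularities.Cruxes.HypersurfaceCentreConstruction.LocalEngine

end
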